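import Summits.AnomalousDissipation.AnomalousDissipation.Theorems.SoloBlindPlanarSteady

/-!
# A dissipation floor forces enstrophy production ≳ ε²/(νE) in steady states (solo soloist, blind mode)

Quantitative necessary condition behind "a steady witness of the zeroth law is a cascade": for a
smooth steady state `(U, P)` of the forced Navier–Stokes system on `T^d` with smooth force `f` and
`ν ≥ 0`, write `E = ∫‖U‖²`, `G = ‖∇U‖₂²` (`Torus.gradNormSq`), and let
`T(U) = ∫⟪(U·∇)U, ΔU⟫ = ∫ tr(∇U (∇U)ᵀ (∇U)ᵀ)` be the **enstrophy production** (minus the periodic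
vortex-stretching integral, `Torus.integral_inner_laplacian_convect_self_eq_neg`; it vanishes
identically in two dimensions, FMRT (A.62)). Then (`steady_production_floor`)

`(ν G)² ≤ ν E · (T(U) + ‖Δf‖₂ E^{1/2})`.

So along a steady family with FIXED `f`, bounded energy `E ≤ E₀` and a dissipation floor
`ε ≤ νⱼ Gⱼ`, the production must blow up: `T(Uⱼ) ≥ ε²/(νⱼ E₀) − ‖Δf‖₂ E₀^{1/2}`
(`production_lower_bound_of_dissipation_floor`), i.e. velocity gradients of size `‖∇U‖₃³ ≳ ε²/(νE)`
— the steady analogue of the Kolmogorov balance "production = ν‖Δu‖²" one derivative up, and the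
reason every finite-dimensional or planar reduction fails (there `T` is bounded or zero). Proof:
steady enstrophy balance `ν∫‖ΔU‖² = T(U) − ∫⟪f, ΔU⟫` (`steady_enstrophy_balance`), Green, Cauchy–Schwarz,
and the interpolation `G² ≤ E ∫‖ΔU‖²` (`gradNormSq_sq_le`).
[cite: FoiasManleyRosaTemam2001, App. II.A (A.55), (A.62)] [cite: DoeringFoias2002, §3]
-/

open MeasureTheory Filter Topology Set
open scoped ENNReal NNReal InnerProductSpace

noncomputable section

namespace Summit.AnomalousDissipation.AnomalousDissipation.Theorems

open Literature.Analysis.FunctionSpaces Literature.Analysis.FluidPDE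

variable {d : Type*} [Fintype d] [DecidableEq d]

/-- **Production floor**: for a smooth steady state on `T^d` with smooth force and `0 ≤ ν`,
`(ν‖∇U‖₂²)² ≤ ν ∫‖U‖² · (∫⟪(U·∇)U, ΔU⟫ + √(∫‖Δf‖² · ∫‖U‖²))`. [cite: FoiasManleyRosaTemam2001, App. II.A (A.55)] -/
theorem steady_production_floor {ν : ℝ} {f U : UnitAddTorus d → EuclideanSpace ℝ d}
    {P : UnitAddTorus d → ℝ} (h : Torus.IsSteadyNSState ν f U P) (hf : Torus.IsSmooth f)
    (hν : 0 ≤ ν) :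
    (ν * Torus.gradNormSq U) ^ 2 ≤
      ν * (∫ x, ‖U x‖ ^ 2) *
        ((∫ x, ⟪Torus.convect U U x, Torus.laplacian U x⟫_ℝ) +
          Real.sqrt ((∫ x, ‖Torus.laplacian f x‖ ^ 2) * ∫ x, ‖U x‖ ^ 2)) := by
  have hU : Torus.IsSmooth U :=
    (Torus.IsClassicalNSSolutionOn.smooth_velocity h).isSmooth_slice (mem_univ (0 : ℝ))
  have hΔ : Torus.IsSmooth (Torus.laplacian U) := hU.laplacian
  have hΔf : Torus.IsSmooth (Torus.laplacian f) := hf.laplacian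
  have hconv : Torus.IsSmooth (Torus.convect U U) := hU.convect hU
  set E : ℝ := ∫ x, ‖U x‖ ^ 2 with hE_def
  set L : ℝ := ∫ x, ‖Torus.laplacian U x‖ ^ 2 with hL_def
  set F : ℝ := ∫ x, ‖Torus.laplacian f x‖ ^ 2 with hF_def
  set T : ℝ := ∫ x, ⟪Torus.convect U U x, Torus.laplacian U x⟫_ℝ with hT_def
  have hE0 : 0 ≤ E := integral_nonneg fun _ => sq_nonneg _
  have hF0 : 0 ≤ F := integral_nonneg fun _ => sq_nonneg _
  -- steady enstrophy balance, split and Green: `ν L = T - ∫⟪f, ΔU⟫ = T - ∫⟪Δf, U⟫`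
  have hbal : ν * L = T - ∫ x, ⟪Torus.laplacian f x, U x⟫_ℝ := by
    have hsplit : ∫ x, ⟪Torus.convect U U x - f x, Torus.laplacian U x⟫_ℝ =
        T - ∫ x, ⟪f x, Torus.laplacian U x⟫_ℝ := by
      simp_rw [inner_sub_left]
      exact integral_sub (hconv.inner hΔ).integrable (hf.inner hΔ).integrable
    rw [hL_def, steady_enstrophy_balance h, hsplit, ← Torus.integral_inner_laplacian_comm hf hU]
  -- Cauchy–Schwarz: `-∫⟪Δf, U⟫ ≤ √(F E)`
  have hUc : Continuous U := hU.continuous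
  have hΔfc : Continuous (Torus.laplacian f) := hΔf.continuous
  have hint : Integrable (fun x => ⟪Torus.laplacian f x, U x⟫_ℝ) volume := (hΔf.inner hU).integrable
  have hEi : Integrable (fun x => ‖U x‖ ^ 2) volume :=
    (hUc.norm.pow 2).integrable_of_hasCompactSupport (HasCompactSupport.of_compactSpace _)
  have hFi : Integrable (fun x => ‖Torus.laplacian f x‖ ^ 2) volume :=
    (hΔfc.norm.pow 2).integrable_of_hasCompactSupport (HasCompactSupport.of_compactSpace _)
  have hcs : -∫ x, ⟪Torus.laplacian f x, U x⟫_ℝ ≤ Real.sqrt (F * E) := by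
    calc -∫ x, ⟪Torus.laplacian f x, U x⟫_ℝ ≤ ∫ x, |⟪Torus.laplacian f x, U x⟫_ℝ| := by
          rw [← integral_neg]
          exact integral_mono hint.neg hint.abs fun x => neg_le_abs _
      _ ≤ Real.sqrt (F * E) := by
          refine integral_le_sqrt_integral_mul_integral (ae_of_all _ fun x => abs_nonneg _)
            (ae_of_all _ fun x => sq_nonneg _) (ae_of_all _ fun x => sq_nonneg _)
            (ae_of_all _ fun x => ?_) (hΔfc.inner hUc).abs.aestronglyMeasurable hFi hEi
          rw [← mul_pow]
          exact pow_le_pow_left₀ (abs_nonneg _) (abs_real_inner_le_norm _ _) 2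
  have hνL : ν * L ≤ T + Real.sqrt (F * E) := by rw [hbal]; linarith
  have h1 : Torus.gradNormSq U ^ 2 ≤ E * L := gradNormSq_sq_le hU
  have hνE : 0 ≤ ν * E := mul_nonneg hν hE0
  calc (ν * Torus.gradNormSq U) ^ 2 = ν * (Torus.gradNormSq U ^ 2) * ν := by ring
    _ ≤ ν * (E * L) * ν := by gcongr
    _ = ν * E * (ν * L) := by ring
    _ ≤ ν * E * (T + Real.sqrt (F * E)) := by gcongr

/-- **A dissipation floor forces unbounded enstrophy production**: if `0 < ν`, `0 < ε ≤ ν‖∇U‖₂²`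
and `∫‖U‖² ≤ E₀` for a smooth steady state with smooth force, then
`ε² ≤ ν E₀ (∫⟪(U·∇)U, ΔU⟫ + √(∫‖Δf‖² E₀))` — so along a steady zeroth-law family the production
`∫⟪(U·∇)U, ΔU⟫ ≳ ε²/(νⱼE₀) → ∞`; in two dimensions the production vanishes identically and the
floor is impossible (`planar_steady_dissipation_tendsto_zero`). [cite: DoeringFoias2002, §3] -/
theorem production_lower_bound_of_dissipation_floor {ν ε E₀ : ℝ}
    {f U : UnitAddTorus d → EuclideanSpace ℝ d} {P : UnitAddTorus d → ℝ}
    (h : Torus.IsSteadyNSState ν f U P) (hf : Torus.IsSmooth f) (hν : 0 < ν) (hε : 0 < ε)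
    (hεU : ε ≤ ν * Torus.gradNormSq U) (hE : ∫ x, ‖U x‖ ^ 2 ≤ E₀) :
    ε ^ 2 ≤ ν * E₀ * ((∫ x, ⟪Torus.convect U U x, Torus.laplacian U x⟫_ℝ) +
      Real.sqrt ((∫ x, ‖Torus.laplacian f x‖ ^ 2) * E₀)) := by
  set T : ℝ := ∫ x, ⟪Torus.convect U U x, Torus.laplacian U x⟫_ℝ with hT_def
  set F : ℝ := ∫ x, ‖Torus.laplacian f x‖ ^ 2 with hF_def
  set E : ℝ := ∫ x, ‖U x‖ ^ 2 with hE_def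
  have hE0 : 0 ≤ E := integral_nonneg fun _ => sq_nonneg _
  have hF0 : 0 ≤ F := integral_nonneg fun _ => sq_nonneg _
  have hE00 : 0 ≤ E₀ := hE0.trans hE
  have hfloor : (ν * Torus.gradNormSq U) ^ 2 ≤ ν * E * (T + Real.sqrt (F * E)) :=
    steady_production_floor h hf hν.le
  have hsq : ε ^ 2 ≤ (ν * Torus.gradNormSq U) ^ 2 := pow_le_pow_left₀ hε.le hεU 2
  have hpos : 0 < ν * E * (T + Real.sqrt (F * E)) :=
    lt_of_lt_of_le (lt_of_lt_of_le (pow_pos hε 2) hsq) hfloor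
  have hνE : 0 ≤ ν * E := mul_nonneg hν.le hE0
  have hbr : 0 < T + Real.sqrt (F * E) := by
    rcases pos_and_pos_or_neg_and_neg_of_mul_pos hpos with ⟨_, h2⟩ | ⟨h1, _⟩
    · exact h2
    · exact absurd h1 (not_lt.2 hνE)
  have hroot : Real.sqrt (F * E) ≤ Real.sqrt (F * E₀) := Real.sqrt_le_sqrt (by gcongr)
  calc ε ^ 2 ≤ (ν * Torus.gradNormSq U) ^ 2 := hsq
    _ ≤ ν * E * (T + Real.sqrt (F * E)) := hfloor
    _ ≤ ν * E₀ * (T + Real.sqrt (F * E₀)) :=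
        mul_le_mul (mul_le_mul_of_nonneg_left hE hν.le) (by linarith) hbr.le
          (mul_nonneg hν.le hE00)

end Summit.AnomalousDissipation.AnomalousDissipation.Theorems

end
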